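import Mathlib
import Summits.ValiantsHypothesis.ValiantsHypothesis.Theorems.RigidityForcesSymmetryRankRigidMinimalReprLaplaceFiveSeparatedCaptureLineInTwoPlanes
import Summits.ValiantsHypothesis.ValiantsHypothesis.Theorems.RigidityForcesSymmetryRankRigidMinimalReprLaplaceFiveSeparatedCaptureSpanTools
import Summits.ValiantsHypothesis.ValiantsHypothesis.Theorems.RigidityForcesSymmetryRankRigidMinimalReprLaplaceFiveSeparatedCaptureBinaryNet
import Summits.ValiantsHypothesis.ValiantsHypothesis.Theorems.RigidityForcesSymmetryRankRigidMinimalReprLaplaceFiveSeparatedCaptureTwoEqualPlusLineTools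

/-!
# ValiantsHypothesis / RigidityForcesSymmetry — crux `LaplaceOptimalFive` (stmt-ValiantsHypothesis-24813), symmetric capture:
# ★★ **`CaptureIneqSym` FOR THE PROFILE «TWO EQUAL PLANES + A LINE-SHARING PLANE» `(P, P, Q)`**

Brick 2 of the `(2,2,2)♭` residue of the K1 lane (val-port-2 g6 ↔ crit-3 g9, 2026-08-29): the cuts `{0,1}` and `{0,2}` carry the
SAME span `P = ⟨u, w⟩` and the cut `{1,2}` carries `Q = ⟨u, v⟩`, `u ≠ 0`, `w ∉ Q` (all matrices symmetric).  Then every space `W`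
of symmetric zero-diagonal leaf matrices captured by `L3 P P Q` has `finrank W ≤ 6 = 2 + 2 + 2` (true capacity `≤ 3`, census
`tel3.py` 1 200 / 1 200).  Route:

* **Reduction (the antisymmetric pencil is pure kernel).**  From ✓ `L3_finite_form`, `T_μ(p,q,r) = A_r(p,q) + B_q(p,r) + C_p(q,r)`
  with `A_x, B_x ∈ P`, `C_x ∈ Q`.  With `M := (A + B)/2`, `M_x = s_x u + t_x w`, the tensor `g := Sym(M) − T_μ` is FULLY SYMMETRIC
  with slices `g_x = M_x − C_x ∈ X := ⟨u, w, v⟩` (the `(2 3)`-symmetry of `T_μ` and the symmetry of `C_x` make the pencil `A − B`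
  drop out), so `g ∈ prolong X` and `t_x w − g_x = C_x − s_x u ∈ Q`:
  `T_μ = Sym(u ⊗ s) + Sym(w ⊗ t) − g` on the representation space `R ∋ (s, t, g)`.
* **Count** (✓ `finrank_map_le_add`, `π = g`, `ρ = s`): on `R ⊓ ker π` the linkage forces `t = 0`, so `Sym(u ⊗ s)` is an obligation,
  hence square-free: `finrank W ≤ finrank (prolong X) + finrank K(u)`, `K(u) := {s : ∀ p r, 2 s_p u_{pr} + s_r u_{pp} = 0}`.
* **Lemma κ.**  `s ∈ K(u)`, `s_p ≠ 0` ⇒ row `p` of `u` vanishes; a nonzero diagonal entry of `u` forces `K(u) = 0`.  Hence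
  (✓ `finrank_prolong_le_four`) `finrank W ≤ 4` if `u` has a nonzero diagonal entry, `≤ 4 + 2` if `u` has three nonzero rows,
  `≤ 3 + 3` if `finrank (prolong X) ≤ 3`.
* **Binary leaf.**  Otherwise `u = c·(E_ab + E_ba)` and `finrank (prolong X) = 4`, so ✓ `exists_rows_le_two_of_finrank_prolong`
  puts all rows of `X` in a plane containing `e_a, e_b`: `X` is supported on `{a,b}²`, every obligation vanishes off the words
  `{a, b, ·}` (✓ `vanish_of_offpair_support`), and `μ ↦ (T_μ(a,b,k))_k` embeds `W` into the indicators of `{a,b}ᶜ`: `finrank W ≤ 3`.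

* Tools (✓ `…SeparatedCaptureTwoEqualPlusLineTools`): `ker_symDiag_eq_zero_of_diag_ne_zero`, `symDiag_row_eq_zero` (Lemma κ),
  `apply_eq_zero_of_mem_of_finrank_le_two` (plane support), `finrank_le_three_of_offpair_vanishing` (the pair read-out).
* ★★ `finrank_le_six_of_two_equal_plus_line` — the count (`finrank W ≤ 6 = 2 + 2 + 2`), generators currency
  (`P = span {u, w}`, `Q = span {u, v}`, `u ≠ 0`, `w ∉ Q`); the submodule-currency wrapper for the K1 consumer is appended in the sequel.

Honest framing.  `(SC)` = `CaptureIneqSym` for ONE more `(2,2,2)♭` profile; the common-line profile (three distinct planes through a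
line), every profile with a span of `finrank ≥ 3` outside ✓ `…_of_disjoint_pair_four`, `CaptureIneqSym` in general, K1 on `K₃ ⊔ K₂`,
`LaplaceOptimalFive` (OPEN · CONTESTED 72/120), `RankRigidMinimalRepr` and `VP ≠ VNP` are NOT proved here.  No definitions, no `sorry`.
-/

set_option linter.dupNamespace false
set_option autoImplicit false

namespace Summit.ValiantsHypothesis.ValiantsHypothesis.Theorems.RigidityForcesSymmetryRankRigidMinimalRepr

namespace LaplaceFiveSeparatedCapture

open Finset

/-! ### The count -/

/-- ★★ **MAIN COUNT for the profile `(P, P, Q)`.**  `u, w, v` symmetric, `u ≠ 0`, `w ∉ Q := ⟨u, v⟩`, `P := ⟨u, w⟩`; every space `W`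
of symmetric zero-diagonal leaf matrices captured by `L3 P P Q` has `finrank W ≤ 6`.  Reduction to `T_μ = Sym(u ⊗ s) + Sym(w ⊗ t) − g`
with `g ∈ prolong ⟨u, w, v⟩`, `t_x w − g_x ∈ Q`; count `finrank W ≤ finrank (prolong X) + #(square-free `Sym(u ⊗ s)`)` by
✓ `finrank_map_le_add`; Lemma κ; the binary leaf by ✓ `exists_rows_le_two_of_finrank_prolong`. [folklore] -/
theorem finrank_le_six_of_two_equal_plus_line (u w v : Fin 5 → Fin 5 → ℂ)
    (hu : ∀ p q, u p q = u q p) (hw : ∀ p q, w p q = w q p) (hv : ∀ p q, v p q = v q p) (hu0 : u ≠ 0)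
    (hwQ : w ∉ Submodule.span ℂ ({u, v} : Set (Fin 5 → Fin 5 → ℂ)))
    (W : Submodule ℂ (Fin 5 → Fin 5 → ℂ))
    (hWs : ∀ μ ∈ W, ∀ s t : Fin 5, μ s t = μ t s) (hWd : ∀ μ ∈ W, ∀ s : Fin 5, μ s s = 0)
    (hWc : ∀ μ ∈ W, contractZ μ ∈
      L3 (Submodule.span ℂ ({u, w} : Set (Fin 5 → Fin 5 → ℂ))) (Submodule.span ℂ ({u, w} : Set (Fin 5 → Fin 5 → ℂ)))
        (Submodule.span ℂ ({u, v} : Set (Fin 5 → Fin 5 → ℂ)))) :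
    Module.finrank ℂ W ≤ 6 := by
  classical
  -- the three spans
  set P : Submodule ℂ (Fin 5 → Fin 5 → ℂ) := Submodule.span ℂ ({u, w} : Set (Fin 5 → Fin 5 → ℂ)) with hPdef
  set Q : Submodule ℂ (Fin 5 → Fin 5 → ℂ) := Submodule.span ℂ ({u, v} : Set (Fin 5 → Fin 5 → ℂ)) with hQdef
  let X : Submodule ℂ (Fin 5 → Fin 5 → ℂ) := Submodule.span ℂ (↑({u, w, v} : Finset (Fin 5 → Fin 5 → ℂ)))
  have hXset : (↑({u, w, v} : Finset (Fin 5 → Fin 5 → ℂ)) : Set (Fin 5 → Fin 5 → ℂ)) = {u, w, v} := by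
    simp only [Finset.coe_insert, Finset.coe_singleton]
  have huX : u ∈ X := Submodule.subset_span (by rw [hXset]; simp)
  have hwX : w ∈ X := Submodule.subset_span (by rw [hXset]; simp)
  have hvX : v ∈ X := Submodule.subset_span (by rw [hXset]; simp)
  have huQ : u ∈ Q := Submodule.subset_span (by simp)
  have hQX : Q ≤ X := by
    rw [hQdef, Submodule.span_le]
    intro x hx
    simp only [Set.mem_insert_iff, Set.mem_singleton_iff] at hx
    rcases hx with rfl | rfl
    · exact huX
    · exact hvX
  have hX3 : Module.finrank ℂ X ≤ 3 :=
    (finrank_span_finset_le_card ({u, w, v} : Finset (Fin 5 → Fin 5 → ℂ))).trans (Finset.card_le_three)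
  have hXs : ∀ x ∈ X, ∀ q r : Fin 5, x q r = x r q := by
    intro x hx q r
    rw [show X = Submodule.span ℂ ({u, w, v} : Set (Fin 5 → Fin 5 → ℂ)) from by rw [← hXset]] at hx
    obtain ⟨c1, y, hy, rfl⟩ := Submodule.mem_span_insert.mp hx
    obtain ⟨c2, c3, rfl⟩ := Submodule.mem_span_pair.mp hy
    simp only [Pi.add_apply, Pi.smul_apply, smul_eq_mul, hu q r, hw q r, hv q r]
  have hQs : ∀ x ∈ Q, ∀ q r : Fin 5, x q r = x r q := fun x hx => hXs x (hQX hx)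
  -- the symmetrised placements `Sym(u ⊗ ·)`, `Sym(w ⊗ ·)` and the placement `x ↦ t_x w`
  let symU : (Fin 5 → ℂ) →ₗ[ℂ] (Fin 5 → Fin 5 → Fin 5 → ℂ) :=
    { toFun := fun a p q r => a p * u q r + a q * u p r + a r * u p q
      map_add' := fun a b => by funext p q r; simp only [Pi.add_apply]; ring
      map_smul' := fun c a => by funext p q r; simp only [Pi.smul_apply, smul_eq_mul, RingHom.id_apply]; ring }
  let symW : (Fin 5 → ℂ) →ₗ[ℂ] (Fin 5 → Fin 5 → Fin 5 → ℂ) :=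
    { toFun := fun a p q r => a p * w q r + a q * w p r + a r * w p q
      map_add' := fun a b => by funext p q r; simp only [Pi.add_apply]; ring
      map_smul' := fun c a => by funext p q r; simp only [Pi.smul_apply, smul_eq_mul, RingHom.id_apply]; ring }
  let tensW : (Fin 5 → ℂ) →ₗ[ℂ] (Fin 5 → Fin 5 → Fin 5 → ℂ) :=
    { toFun := fun a x q r => a x * w q r
      map_add' := fun a b => by funext x q r; simp only [Pi.add_apply]; ring
      map_smul' := fun c a => by funext x q r; simp only [Pi.smul_apply, smul_eq_mul, RingHom.id_apply]; ring }
  have hsymU : ∀ a p q r, symU a p q r = a p * u q r + a q * u p r + a r * u p q := fun _ _ _ _ => rfl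
  have hsymW : ∀ a p q r, symW a p q r = a p * w q r + a q * w p r + a r * w p q := fun _ _ _ _ => rfl
  have htensW : ∀ a x q r, tensW a x q r = a x * w q r := fun _ _ _ _ => rfl
  -- the representation space `Xsp ∋ (s, t, g)` and its maps
  let Xsp := (Fin 5 → ℂ) × ((Fin 5 → ℂ) × (Fin 5 → Fin 5 → Fin 5 → ℂ))
  let πs : Xsp →ₗ[ℂ] (Fin 5 → ℂ) := LinearMap.fst ℂ _ _
  let πt : Xsp →ₗ[ℂ] (Fin 5 → ℂ) := (LinearMap.fst ℂ _ _).comp (LinearMap.snd ℂ _ _)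
  let πg : Xsp →ₗ[ℂ] (Fin 5 → Fin 5 → Fin 5 → ℂ) := (LinearMap.snd ℂ _ _).comp (LinearMap.snd ℂ _ _)
  let Φ : Xsp →ₗ[ℂ] (Fin 5 → Fin 5 → Fin 5 → ℂ) := symU.comp πs + symW.comp πt - πg
  let lam : Xsp →ₗ[ℂ] (Fin 5 → Fin 5 → Fin 5 → ℂ) := tensW.comp πt - πg
  have hΦ : ∀ x : Xsp, ∀ p q r, Φ x p q r =
      (x.1 p * u q r + x.1 q * u p r + x.1 r * u p q) + (x.2.1 p * w q r + x.2.1 q * w p r + x.2.1 r * w p q) - x.2.2 p q r :=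
    fun x p q r => rfl
  have hlam : ∀ x : Xsp, ∀ y q r, lam x y q r = x.2.1 y * w q r - x.2.2 y q r := fun x y q r => rfl
  have hπs : ∀ x : Xsp, πs x = x.1 := fun x => rfl
  have hπt : ∀ x : Xsp, πt x = x.2.1 := fun x => rfl
  have hπg : ∀ x : Xsp, πg x = x.2.2 := fun x => rfl
  let Qpi : Submodule ℂ (Fin 5 → Fin 5 → Fin 5 → ℂ) := Submodule.pi Set.univ (fun _ : Fin 5 => Q)
  let R : Submodule ℂ Xsp := (W.map cZ).comap Φ ⊓ ((prolong X).comap πg ⊓ Qpi.comap lam)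
  -- linkage: on `R`, `g = 0` forces `t = 0` (because `w ∉ Q`)
  have ht0 : ∀ x ∈ R, πg x = 0 → x.2.1 = 0 := by
    intro x hx hg0
    obtain ⟨-, hxr⟩ := Submodule.mem_inf.mp hx
    obtain ⟨-, hxl⟩ := Submodule.mem_inf.mp hxr
    rw [Submodule.mem_comap, Submodule.mem_pi] at hxl
    rw [hπg] at hg0
    funext y
    by_contra hty
    have hy := hxl y (Set.mem_univ y)
    have e : lam x y = x.2.1 y • w := by
      funext q r
      rw [hlam, hg0, Pi.zero_apply, Pi.zero_apply, Pi.zero_apply, sub_zero, Pi.smul_apply, Pi.smul_apply, smul_eq_mul]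
    rw [e] at hy
    have : w ∈ Q := by
      have h2 := Q.smul_mem (x.2.1 y)⁻¹ hy
      rwa [smul_smul, inv_mul_cancel₀ hty, one_smul] at h2
    exact hwQ this
  have hρ : ∀ x ∈ R, πg x = 0 → πs x = 0 → x = 0 := by
    intro x hx hg0 hs0
    have ht := ht0 x hx hg0
    rw [hπg] at hg0
    rw [hπs] at hs0
    exact Prod.ext hs0 (Prod.ext ht hg0)
  -- every obligation lies in `Φ(R)`: the reduction `T_μ = Sym(M) − g`
  have hmem : ∀ μ ∈ W, contractZ μ ∈ R.map Φ := by
    intro μ hμ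
    obtain ⟨A, B, C, hA, hB, hC, hT⟩ := L3_finite_form P P Q (hWc μ hμ)
    have hAc : ∀ y, ∃ c d : ℂ, c • u + d • w = A y := fun y => Submodule.mem_span_pair.mp (hA y)
    have hBc : ∀ y, ∃ c d : ℂ, c • u + d • w = B y := fun y => Submodule.mem_span_pair.mp (hB y)
    choose αA βA hαA using hAc
    choose αB βB hαB using hBc
    have hA' : ∀ y p q, A y p q = αA y * u p q + βA y * w p q := fun y p q => by
      rw [← hαA y]
      simp only [Pi.add_apply, Pi.smul_apply, smul_eq_mul]
    have hB' : ∀ y p q, B y p q = αB y * u p q + βB y * w p q := fun y p q => by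
      rw [← hαB y]
      simp only [Pi.add_apply, Pi.smul_apply, smul_eq_mul]
    -- `M = (A + B)/2 = s u + t w`
    let s : Fin 5 → ℂ := fun y => (αA y + αB y) / 2
    let t : Fin 5 → ℂ := fun y => (βA y + βB y) / 2
    have hsd : ∀ y, s y = (αA y + αB y) / 2 := fun _ => rfl
    have htd : ∀ y, t y = (βA y + βB y) / 2 := fun _ => rfl
    let g : Fin 5 → Fin 5 → Fin 5 → ℂ := fun p q r =>
      (s p * u q r + s q * u p r + s r * u p q) + (t p * w q r + t q * w p r + t r * w p q) - contractZ μ p q r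
    have hgd : ∀ p q r, g p q r =
        (s p * u q r + s q * u p r + s r * u p q) + (t p * w q r + t q * w p r + t r * w p q) - contractZ μ p q r :=
      fun _ _ _ => rfl
    -- the pencil symmetry `A_r(x,q) − B_r(x,q) = A_q(x,r) − B_q(x,r)` from the `(2 3)`-symmetry of `T_μ`
    have hN : ∀ x q r, A r x q - B r x q = A q x r - B q x r := by
      intro x q r
      have h := contractZ_swap23 μ x q r
      rw [hT, hT] at h
      have hc := hQs _ (hC x) r q
      linear_combination hc - h
    -- the slices of `g`
    have hgslice : ∀ x q r, g x q r = s x * u q r + t x * w q r - C x q r := by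
      intro x q r
      rw [hgd, hT x q r, hA' r x q, hB' q x r, hsd, hsd, hsd, htd, htd, htd]
      have e := hN x q r
      rw [hA' r x q, hB' r x q, hA' q x r, hB' q x r] at e
      linear_combination (-(1 / 2) : ℂ) * e
    have hgx : ∀ x, g x = s x • u + t x • w - C x := by
      intro x
      funext q r
      simp only [hgslice, Pi.sub_apply, Pi.add_apply, Pi.smul_apply, smul_eq_mul]
    have hg12 : ∀ p q r, g p q r = g q p r := by
      intro p q r
      rw [hgd, hgd, contractZ_swap12 μ p q r, hu q p, hw q p]
      ring
    have hg23 : ∀ p q r, g p q r = g p r q := by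
      intro p q r
      rw [hgd, hgd, contractZ_swap23 μ p q r, hu r q, hw r q]
      ring
    have hgp : g ∈ prolong X := by
      refine (mem_prolong_iff X g).mpr ⟨hg12, hg23, fun x => ?_⟩
      rw [hgx]
      exact X.sub_mem (X.add_mem (X.smul_mem _ huX) (X.smul_mem _ hwX)) (hQX (hC x))
    have hrep : Φ (s, (t, g)) = contractZ μ := by
      funext p q r
      rw [hΦ]
      show (s p * u q r + s q * u p r + s r * u p q) + (t p * w q r + t q * w p r + t r * w p q) - g p q r
        = contractZ μ p q r
      rw [hgd]
      ring
    refine Submodule.mem_map.mpr ⟨(s, (t, g)), Submodule.mem_inf.mpr ⟨?_, Submodule.mem_inf.mpr ⟨?_, ?_⟩⟩, hrep⟩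
    · rw [Submodule.mem_comap, hrep]
      exact Submodule.mem_map.mpr ⟨μ, hμ, cZ_apply μ⟩
    · rw [Submodule.mem_comap]
      exact hgp
    · rw [Submodule.mem_comap, Submodule.mem_pi]
      intro y _
      have e : lam (s, (t, g)) y = C y - s y • u := by
        funext q r
        rw [hlam]
        show t y * w q r - g y q r = (C y - s y • u) q r
        rw [hgslice, Pi.sub_apply, Pi.smul_apply, Pi.sub_apply, Pi.smul_apply, smul_eq_mul]
        ring
      rw [e]
      exact Q.sub_mem (hC y) (Q.smul_mem _ huQ)
  -- the injection `W ↪ Φ(R)`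
  let f : W →ₗ[ℂ] (R.map Φ) := LinearMap.codRestrict (R.map Φ) (cZ.domRestrict W) (fun μ => by
    simpa [cZ_apply] using hmem μ.1 μ.2)
  have hf : Function.Injective f := by
    rw [injective_iff_map_eq_zero]
    intro μ hμ
    have hT : contractZ μ.1 = 0 := by
      have := congrArg Subtype.val hμ
      simpa [f, cZ_apply] using this
    apply Subtype.ext
    refine hub_injective μ.1 (hWs μ.1 μ.2) (hWd μ.1 μ.2) fun p q => ?_
    simp [hT]
  have hW_le := LinearMap.finrank_le_finrank_of_injective hf
  -- the count `finrank Φ(R) ≤ finrank (prolong X) + finrank K(u)`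
  have hadd := finrank_map_le_add Φ πg πs R hρ
  have hπgle : R.map πg ≤ prolong X := by
    rw [Submodule.map_le_iff_le_comap]
    exact inf_le_right.trans inf_le_left
  have h1 : Module.finrank ℂ (R.map πg) ≤ Module.finrank ℂ (prolong X) := Submodule.finrank_mono hπgle
  have hp4 : Module.finrank ℂ (prolong X) ≤ 4 := finrank_prolong_le_four X hXs hX3
  -- the square-freeness space `K(u)` as a kernel
  let D : (Fin 5 → ℂ) →ₗ[ℂ] (Fin 5 → Fin 5 → ℂ) :=
    { toFun := fun a p r => a p * u p r + a p * u p r + a r * u p p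
      map_add' := fun a b => by funext p r; simp only [Pi.add_apply]; ring
      map_smul' := fun c a => by funext p r; simp only [Pi.smul_apply, smul_eq_mul, RingHom.id_apply]; ring }
  have hD : ∀ a p r, D a p r = a p * u p r + a p * u p r + a r * u p p := fun _ _ _ => rfl
  have hKle : (R ⊓ LinearMap.ker πg).map πs ≤ LinearMap.ker D := by
    intro a ha
    obtain ⟨x, hx, rfl⟩ := Submodule.mem_map.mp ha
    obtain ⟨hxR, hxk⟩ := Submodule.mem_inf.mp hx
    have hg0 : πg x = 0 := LinearMap.mem_ker.mp hxk
    have ht := ht0 x hxR hg0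
    rw [hπg] at hg0
    obtain ⟨hxW, -⟩ := Submodule.mem_inf.mp hxR
    rw [Submodule.mem_comap] at hxW
    obtain ⟨μ, -, hμ⟩ := Submodule.mem_map.mp hxW
    rw [LinearMap.mem_ker]
    funext p r
    rw [hD, hπs, Pi.zero_apply, Pi.zero_apply]
    have e := congrFun (congrFun (congrFun hμ p) p) r
    rw [cZ_apply, contractZ_rep12, hΦ, ht, hg0] at e
    simp only [Pi.zero_apply, zero_mul, add_zero, sub_zero] at e
    linear_combination -e
  have h2 : Module.finrank ℂ ((R ⊓ LinearMap.ker πg).map πs) ≤ Module.finrank ℂ (LinearMap.ker D) :=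
    Submodule.finrank_mono hKle
  have hKD : ∀ a ∈ LinearMap.ker D, ∀ p r : Fin 5, a p * u p r + a p * u p r + a r * u p p = 0 := by
    intro a ha p r
    have := congrFun (congrFun (LinearMap.mem_ker.mp ha) p) r
    rwa [hD] at this
  -- CASE A: a nonzero diagonal entry of `u` ⇒ `K(u) = 0`, `finrank W ≤ 4`
  by_cases hdiag : ∃ q, u q q ≠ 0
  · obtain ⟨q, hq⟩ := hdiag
    have hbot : LinearMap.ker D = ⊥ := by
      apply eq_bot_iff.mpr
      intro a ha
      rw [Submodule.mem_bot]
      exact ker_symDiag_eq_zero_of_diag_ne_zero u q hq a (hKD a ha)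
    have hK0 : Module.finrank ℂ (LinearMap.ker D) = 0 := by
      rw [hbot, finrank_bot]
    omega
  push Not at hdiag
  -- `u` has zero diagonal; pick an off-diagonal entry `u a b ≠ 0`
  have hab : ∃ a b : Fin 5, a ≠ b ∧ u a b ≠ 0 := by
    by_contra hcon
    push Not at hcon
    apply hu0
    funext p q
    by_cases hpq : p = q
    · subst hpq; exact hdiag p
    · exact hcon p q hpq
  obtain ⟨a, b, hab, huab⟩ := hab
  have huba : u b a ≠ 0 := by rwa [hu b a]
  -- the zero rows of `u` and `K(u) ≤ indicators of the zero rows`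
  let Z : Finset (Fin 5) := Finset.univ.filter (fun p => ∀ r, u p r = 0)
  have hZmem : ∀ p, p ∈ Z ↔ ∀ r, u p r = 0 := fun p => by simp [Z]
  have hKZ : LinearMap.ker D ≤
      Submodule.span ℂ (↑(Z.image fun k : Fin 5 => fun j : Fin 5 => if k = j then (1 : ℂ) else 0) : Set (Fin 5 → ℂ)) := by
    intro s' hs'
    refine mem_span_indicators s' Z fun k hk => ?_
    by_contra hne
    exact hk ((hZmem k).mpr (symDiag_row_eq_zero u hdiag s' (hKD s' hs') k hne))
  have hKcard : Module.finrank ℂ (LinearMap.ker D) ≤ Z.card :=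
    (Submodule.finrank_mono hKZ).trans (finrank_span_indicators_le Z)
  have haZ : a ∉ Z := fun h => huab ((hZmem a).mp h b)
  have hbZ : b ∉ Z := fun h => huba ((hZmem b).mp h a)
  -- CASE B1: a third nonzero row ⇒ `card Z ≤ 2`
  by_cases hthird : ∃ p r, p ≠ a ∧ p ≠ b ∧ u p r ≠ 0
  · obtain ⟨p, r, hpa, hpb, hupr⟩ := hthird
    have hpZ : p ∉ Z := fun h => hupr ((hZmem p).mp h r)
    have hZsub : Z ⊆ ({a, b, p} : Finset (Fin 5))ᶜ := by
      intro k hk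
      rw [Finset.mem_compl]
      simp only [Finset.mem_insert, Finset.mem_singleton, not_or]
      exact ⟨fun h => haZ (h ▸ hk), fun h => hbZ (h ▸ hk), fun h => hpZ (h ▸ hk)⟩
    have hc3 : ({a, b, p} : Finset (Fin 5)).card = 3 := by
      rw [Finset.card_insert_of_notMem (by simp [hab, hpa.symm]), Finset.card_insert_of_notMem (by simp [hpb.symm]),
        Finset.card_singleton]
    have hZc : Z.card ≤ 2 := by
      have := Finset.card_le_card hZsub
      rw [Finset.card_compl, hc3, Fintype.card_fin] at this
      omega
    omega
  push Not at hthird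
  -- CASE B2: `u` is supported on `{a, b}`: `card Z ≤ 3`
  have hZsub : Z ⊆ ({a, b} : Finset (Fin 5))ᶜ := by
    intro k hk
    rw [Finset.mem_compl]
    simp only [Finset.mem_insert, Finset.mem_singleton, not_or]
    exact ⟨fun h => haZ (h ▸ hk), fun h => hbZ (h ▸ hk)⟩
  have hc2 : ({a, b} : Finset (Fin 5)).card = 2 := by
    rw [Finset.card_insert_of_notMem (by simp [hab]), Finset.card_singleton]
  have hZc : Z.card ≤ 3 := by
    have := Finset.card_le_card hZsub
    rw [Finset.card_compl, hc2, Fintype.card_fin] at this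
    omega
  by_cases hp3 : Module.finrank ℂ (prolong X) ≤ 3
  · omega
  -- BINARY LEAF: `finrank (prolong X) = 4`, all rows of `X` lie in a plane containing `e_a, e_b`
  push Not at hp3
  obtain ⟨p0, hL2, hrows⟩ := exists_rows_le_two_of_finrank_prolong X hXs hX3 (by omega)
  -- rows of `u`: `u a = c • e_b`, `u b = c • e_a`
  have hua : u a = u a b • (fun j : Fin 5 => if b = j then (1 : ℂ) else 0) := by
    funext r
    rw [Pi.smul_apply, smul_eq_mul]
    by_cases hrb : b = r
    · subst hrb; simp
    · rw [if_neg hrb, mul_zero]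
      by_cases hra : r = a
      · subst hra; exact hdiag r
      · rw [hu a r]; exact hthird r a hra (Ne.symm hrb)
  have hub : u b = u b a • (fun j : Fin 5 => if a = j then (1 : ℂ) else 0) := by
    funext r
    rw [Pi.smul_apply, smul_eq_mul]
    by_cases hra : a = r
    · subst hra; simp
    · rw [if_neg hra, mul_zero]
      by_cases hrb : r = b
      · subst hrb; exact hdiag r
      · rw [hu b r]; exact hthird r b (Ne.symm hra) hrb
  have heb : (fun j : Fin 5 => if b = j then (1 : ℂ) else 0) ∈ rowIm X p0 := by
    have h1 : u a b • (fun j : Fin 5 => if b = j then (1 : ℂ) else 0) ∈ rowIm X p0 := by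
      rw [← hua]; exact hrows u huX a
    have h := (rowIm X p0).smul_mem (u a b)⁻¹ h1
    rwa [smul_smul, inv_mul_cancel₀ huab, one_smul] at h
  have hea : (fun j : Fin 5 => if a = j then (1 : ℂ) else 0) ∈ rowIm X p0 := by
    have h1 : u b a • (fun j : Fin 5 => if a = j then (1 : ℂ) else 0) ∈ rowIm X p0 := by
      rw [← hub]; exact hrows u huX b
    have h := (rowIm X p0).smul_mem (u b a)⁻¹ h1
    rwa [smul_smul, inv_mul_cancel₀ huba, one_smul] at h
  -- `X` is supported on `{a, b} × {a, b}`
  have hXab : ∀ x ∈ X, ∀ q r, r ≠ a → r ≠ b → x q r = 0 := fun x hx q r hra hrb =>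
    apply_eq_zero_of_mem_of_finrank_le_two (rowIm X p0) hL2 a b hab hea heb (x q) (hrows x hx q) r hra hrb
  have hXab' : ∀ x ∈ X, ∀ q r, q ≠ a → q ≠ b → x q r = 0 := fun x hx q r hqa hqb => by
    rw [hXs x hx q r]; exact hXab x hx r q hqa hqb
  -- every obligation vanishes on words whose first two letters avoid `{a, b}`
  have hvan : ∀ μ ∈ W, ∀ p q r, p ≠ a → p ≠ b → q ≠ a → q ≠ b → contractZ μ p q r = 0 := by
    intro μ hμ p q r hpa hpb hqa hqb
    obtain ⟨x, hx, hxμ⟩ := Submodule.mem_map.mp (hmem μ hμ)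
    obtain ⟨-, hxr⟩ := Submodule.mem_inf.mp hx
    obtain ⟨hxP, -⟩ := Submodule.mem_inf.mp hxr
    rw [Submodule.mem_comap, hπg] at hxP
    obtain ⟨-, -, hslice⟩ := (mem_prolong_iff X _).mp hxP
    have hupq : u p q = 0 := hthird p q hpa hpb
    have hupr : u p r = 0 := hthird p r hpa hpb
    have huqr : u q r = 0 := hthird q r hqa hqb
    have hwpq : w p q = 0 := hXab' w hwX p q hpa hpb
    have hwpr : w p r = 0 := hXab' w hwX p r hpa hpb
    have hwqr : w q r = 0 := hXab' w hwX q r hqa hqb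
    have hgpqr : x.2.2 p q r = 0 := hXab' (x.2.2 p) (hslice p) q r hqa hqb
    rw [← hxμ, hΦ, hupq, hupr, huqr, hwpq, hwpr, hwqr, hgpqr]
    ring
  exact (finrank_le_three_of_offpair_vanishing a b hab W hWs hWd hvan).trans (by norm_num)

end LaplaceFiveSeparatedCapture

end Summit.ValiantsHypothesis.ValiantsHypothesis.Theorems.RigidityForcesSymmetryRankRigidMinimalRepr
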